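import Summits.HodgeConjecture.CorCM.IrreducibleOddWeightsShadowIdeals
import HarnessLib

/-!
# Shadow ideals, II: the exact criterion on the pivot — no equivariant endomorphisms of `ℚ^Y` collide the two shadows

COR-CM (cell `pub-hodgecm2`, binder seat `b16` gen 63, count-neutral claim SHADOW IDEALS, file S2 — abstract `G`-set
level; theorems only, no definition, no named fact, no `sorry`).  NEW as stated, hence under `Summits/`.  HONEST FRAMING:
finite-dimensional linear algebra about the Kubota–Dodson rank of a pair of CM types (`Hg(A₀ × A₁)` versus
`Hg(A₀) × Hg(A₁)`); `HC_CM` is neither used nor asserted.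

SETTING of file S1 (`IrreducibleOddWeightsShadowIdeals`): two slots `E_{i₀}`, `E_{i₁}`, a finite `G`-set `Y` (the
PIVOT) with equivariant surjections `r_κ : E_{i_κ} → Y`, a fibre-transitive set `N ⊆ G` inside the subgroup generated by
the pointwise stabilisers of the two slots, and the SHADOWS `w_κ = (r_κ)_* u_1(Φ_{i_κ}) ∈ ℚ^Y`.  S1 reduced additivity of
the pair to the evaluation criterion for `w₀, w₁` in irreducible representations RECEIVING equivariant maps from `ℚ^Y`.

* §1 **`exists_equivariant_injective_of_irreducible`**: an irreducible representation receiving a NON-ZERO equivariant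
  map `S` from the permutation module `ℚ^Y` embeds equivariantly INTO `ℚ^Y` — `S` is bijective on the orthogonal
  complement of `ker S` for the invariant dot product (self-duality of permutation modules; no Maschke theorem, `G`
  arbitrary).
* §2 **`forall_map_slotExt_le_of_not_exists_shadow_collision`** — ENDOMORPHISM FORM of the reduction: if NO two
  `G`-equivariant endomorphisms `α, β` of `ℚ^Y` have `α(w₀) = β(w₁) ≠ 0`, the pair is additive;
  **`typeRank_sigmaType_add_card_eq_iff_not_exists_shadow_collision`** — THE EXACT CRITERION:
  `rank(Φ₀, Φ₁) + 2 = rank Φ₀ + rank Φ₁ + 1` (`Hg(A₀ × A₁) = Hg(A₀) × Hg(A₁)`) **iff** no equivariant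
  `α, β ∈ End_G(ℚ^Y)` collide the shadows (⟹ is S1's collision theorem, unconditional); nondegeneracy form
  `typeRank_sigmaType_eq_iff_forall_of_not_exists_shadow_collision`.  So the additivity of the pair is decided by the two
  vectors `w₀, w₁ ∈ ℚ^Y` and the Hecke algebra `End_G(ℚ^Y)`: in the language of modules, **iff the `End_G(ℚ^Y)`-submodules
  generated by `w₀` and by `w₁` meet in `0`** (file S3 `IrreducibleOddWeightsShadowIdealsHecke` makes the algebra explicit
  for a torsor `Y`).

## References

* [Gordon1999HodgeAVSurvey] B. B. Gordon, *A survey of the Hodge conjecture for abelian varieties*, §3 Theorem (Imai,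
  Murty) with proof, 7.5–7.7.
* [Mai1989] L. Mai, *Lower bounds for the ranks of CM types*, J. Number Theory 32 (1989), §2 Prop. 1 (proof).
* [Serre1977] J.-P. Serre, *Linear Representations of Finite Groups*, GTM 42, §2.2 Prop. 4.
* [Deligne1982HodgeCycles] P. Deligne, *Hodge cycles on abelian varieties*, LNM 900 (1982), I Ex. 3.7.
-/

set_option autoImplicit false

noncomputable section

open scoped BigOperators

universe u v v' w

namespace Summit.HodgeConjecture.CorCM.IrrOdd

open Literature.NumberTheory.ComplexMultiplication

variable {G : Type w} [Group G]

/-! ### §1 Irreducible quotients of the permutation module `ℚ^Y` embed back into `ℚ^Y` -/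

section Embedding

variable {Y : Type v'} [MulAction G Y] [Fintype Y]

/-- The dot product on `ℚ^Y` is invariant under permutations. [folklore] -/
private theorem dotProduct_comp_smul' (f f' : Y → ℚ) (g : G) :
    (fun x => f (g • x)) ⬝ᵥ (fun x => f' (g • x)) = f ⬝ᵥ f' :=
  Fintype.sum_equiv (MulAction.toPerm g) _ _ fun _ => rfl

/-- The orthogonal complement of a stable subspace is stable. [folklore] -/
private theorem comp_smul_mem_orthogonal' {W : Submodule ℚ (Y → ℚ)}
    (hW : ∀ g : G, ∀ f ∈ W, (fun x => f (g • x)) ∈ W) {m : Y → ℚ}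
    (hm : m ∈ LinearMap.BilinForm.orthogonal (dotProductBilin ℚ ℚ) W) (g : G) :
    (fun x => m (g • x)) ∈ LinearMap.BilinForm.orthogonal (dotProductBilin ℚ ℚ) W := by
  rw [LinearMap.BilinForm.mem_orthogonal_iff] at hm ⊢
  intro n hn
  have h1 := hm (fun x => n (g⁻¹ • x)) (hW g⁻¹ n hn)
  change _ ⬝ᵥ _ = 0 at h1
  change n ⬝ᵥ _ = 0
  rw [← dotProduct_comp_smul' (fun x => n (g⁻¹ • x)) m g] at h1
  simpa only [inv_smul_smul] using h1

omit [MulAction G Y] in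
/-- **Every subspace of `ℚ^Y` is complemented by its orthogonal complement** for the dot product (a positive definite
form over `ℚ`). [folklore] -/
theorem isCompl_dotProduct_orthogonal (W : Submodule ℚ (Y → ℚ)) :
    IsCompl W (LinearMap.BilinForm.orthogonal (dotProductBilin ℚ ℚ) W) := by
  refine LinearMap.BilinForm.isCompl_orthogonal_of_restrict_nondegenerate (fun x y hxy => ?_) ⟨fun m hm => ?_, fun m hm => ?_⟩
  · change x ⬝ᵥ y = 0 at hxy
    change y ⬝ᵥ x = 0
    rwa [dotProduct_comm]
  all_goals
    have h := hm m
    rw [LinearMap.BilinForm.restrict_apply] at h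
    change (m : Y → ℚ) ⬝ᵥ (m : Y → ℚ) = 0 at h
    exact Subtype.ext (dotProduct_self_eq_zero.1 h)

/-- **An irreducible representation receiving a NON-ZERO equivariant map from the permutation module `ℚ^Y` embeds
equivariantly into `ℚ^Y`** (it is the image of the orthogonal complement of the kernel, on which the map is bijective).
[cite: Serre1977, §2.2 Prop. 4] -/
theorem exists_equivariant_injective_of_irreducible {V : Type*} [AddCommGroup V] [Module ℚ V]
    (π : Representation ℚ G V) (hπ : π.IsIrreducible) (S : (Y → ℚ) →ₗ[ℚ] V)
    (hS : ∀ (g : G) (f : Y → ℚ), S (fun y => f (g⁻¹ • y)) = π g (S f)) (hS0 : S ≠ 0) :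
    ∃ ι : V →ₗ[ℚ] (Y → ℚ), Function.Injective ι ∧ ∀ (g : G) (v : V), ι (π g v) = fun y => ι v (g⁻¹ • y) := by
  set K : Submodule ℚ (Y → ℚ) := LinearMap.ker S with hK
  set P : Submodule ℚ (Y → ℚ) := LinearMap.BilinForm.orthogonal (dotProductBilin ℚ ℚ) K with hP
  have hKst : ∀ g : G, ∀ f ∈ K, (fun y => f (g • y)) ∈ K := fun g f hf => by
    rw [hK, LinearMap.mem_ker] at hf ⊢
    have h1 := hS g⁻¹ f
    rw [inv_inv] at h1
    rw [h1, hf, map_zero]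
  have hPst : ∀ g : G, ∀ f ∈ P, (fun y => f (g • y)) ∈ P := fun g f hf => comp_smul_mem_orthogonal' hKst hf g
  have hc : IsCompl K P := isCompl_dotProduct_orthogonal K
  -- `S` is onto (irreducibility)
  have hrange : LinearMap.range S = ⊤ := by
    obtain ⟨f₀, hf₀⟩ : ∃ f₀, S f₀ ≠ 0 := by
      by_contra hall
      push Not at hall
      exact hS0 (LinearMap.ext hall)
    let R : Subrepresentation π := ⟨LinearMap.range S, fun g' v hv' => by
      obtain ⟨f, rfl⟩ := hv'
      exact ⟨fun y => f (g'⁻¹ • y), hS g' f⟩⟩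
    rcases hπ.eq_bot_or_eq_top R with hR | hR
    · exfalso
      apply hf₀
      have hmem : S f₀ ∈ R.toSubmodule := ⟨f₀, rfl⟩
      rw [hR] at hmem
      exact (Submodule.mem_bot ℚ).1 hmem
    · exact congrArg Subrepresentation.toSubmodule hR
  -- `S|_P : P ≅ V`
  have hbij : Function.Bijective (S.domRestrict P) := by
    refine ⟨fun a b hab => ?_, fun v => ?_⟩
    · have hk : ((a : Y → ℚ) - b) ∈ K := by
        rw [hK, LinearMap.mem_ker, map_sub]
        exact sub_eq_zero.2 hab
      have hmem : ((a : Y → ℚ) - b) ∈ K ⊓ P := ⟨hk, P.sub_mem a.2 b.2⟩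
      rw [hc.inf_eq_bot, Submodule.mem_bot] at hmem
      exact Subtype.ext (sub_eq_zero.1 hmem)
    · have hv : v ∈ LinearMap.range S := hrange ▸ Submodule.mem_top
      obtain ⟨f, rfl⟩ := hv
      obtain ⟨k, hk, p, hp, rfl⟩ := Submodule.mem_sup.1 (hc.sup_eq_top.symm ▸ Submodule.mem_top (x := f))
      refine ⟨⟨p, hp⟩, ?_⟩
      change S p = S (k + p)
      rw [map_add, LinearMap.mem_ker.1 hk, zero_add]
  let e : P ≃ₗ[ℚ] V := LinearEquiv.ofBijective (S.domRestrict P) hbij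
  have he : ∀ p : P, e p = S p := fun p => rfl
  refine ⟨P.subtype ∘ₗ e.symm.toLinearMap, Subtype.val_injective.comp e.symm.injective, fun g v => ?_⟩
  obtain ⟨p, rfl⟩ := e.surjective v
  have hgp : (fun y => (p : Y → ℚ) (g⁻¹ • y)) ∈ P := hPst g⁻¹ p p.2
  have h1 : e ⟨fun y => (p : Y → ℚ) (g⁻¹ • y), hgp⟩ = π g (e p) := by
    rw [he, he]
    exact hS g p
  change ((e.symm (π g (e p)) : P) : Y → ℚ) = fun y => ((e.symm (e p) : P) : Y → ℚ) (g⁻¹ • y)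
  rw [← h1, LinearEquiv.symm_apply_apply, LinearEquiv.symm_apply_apply]

end Embedding

/-! ### §2 The endomorphism form of the reduction and the exact criterion -/

section Criterion

variable {I : Type u} {E : I → Type v} [∀ i, MulAction G (E i)] [DecidableEq I] [Fintype I] [∀ i, Fintype (E i)]
  {Y : Type v'} [MulAction G Y] [Fintype Y] [DecidableEq Y]

/-- **ENDOMORPHISM FORM OF THE REDUCTION.**  Under the hypotheses of `forall_map_slotExt_le_of_forall_shadow` (fibre
transitivity of `N`, `N` inside the subgroup generated by the pointwise stabilisers, `r_κ` surjective): if NO two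
`G`-equivariant endomorphisms `α, β` of the permutation module `ℚ^Y` have `α(w₀) = β(w₁) ≠ 0`, then the pair is additive
(`Hg(A₀ × A₁) = Hg(A₀) × Hg(A₁)`). [cite: Gordon1999HodgeAVSurvey, §3 Theorem (proof)] [cite: Serre1977, §2.2 Prop. 4] -/
theorem forall_map_slotExt_le_of_not_exists_shadow_collision {Φ : ∀ i, Set (E i)} {i₀ i₁ : I}
    (hI : ∀ j, j = i₀ ∨ j = i₁) (h01 : i₀ ≠ i₁) (r₀ : E i₀ → Y) (r₁ : E i₁ → Y)
    (hr₀ : ∀ (g : G) (x : E i₀), r₀ (g • x) = g • r₀ x) (hr₁ : ∀ (g : G) (x : E i₁), r₁ (g • x) = g • r₁ x)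
    (hs₀ : Function.Surjective r₀) (hs₁ : Function.Surjective r₁) (N : Set G)
    (hN₀ : ∀ x x' : E i₀, r₀ x = r₀ x' → ∃ n ∈ N, n • x = x')
    (hN₁ : ∀ x x' : E i₁, r₁ x = r₁ x' → ∃ n ∈ N, n • x = x')
    (hNcl : N ⊆ Subgroup.closure ({g : G | ∀ x : E i₀, g • x = x} ∪ {g : G | ∀ x : E i₁, g • x = x}))
    (hno : ¬ ∃ α β : (Y → ℚ) →ₗ[ℚ] (Y → ℚ),
      (∀ (g : G) (f : Y → ℚ), α (fun y => f (g⁻¹ • y)) = fun y => α f (g⁻¹ • y)) ∧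
      (∀ (g : G) (f : Y → ℚ), β (fun y => f (g⁻¹ • y)) = fun y => β f (g⁻¹ • y)) ∧
      α (fun y => ∑ x ∈ Finset.univ.filter (fun x => r₀ x = y), antiVec (Φ i₀) (1 : G) x) =
        β (fun y => ∑ x ∈ Finset.univ.filter (fun x => r₁ x = y), antiVec (Φ i₁) (1 : G) x) ∧
      α (fun y => ∑ x ∈ Finset.univ.filter (fun x => r₀ x = y), antiVec (Φ i₀) (1 : G) x) ≠ 0) :
    ∀ i, (antiSpan G (Φ i)).map (slotExt i) ≤ antiSpan G (sigmaType Φ) := by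
  refine forall_map_slotExt_le_of_forall_shadow hI h01 r₀ r₁ hr₀ hr₁ hs₀ hs₁ N hN₀ hN₁ hNcl
    fun V _ _ _ π hπ α β hα hβ hsum => ?_
  by_contra hne
  have hα0 : α ≠ 0 := fun h0 => hne (by rw [h0, LinearMap.zero_apply])
  obtain ⟨ι, hιinj, hι⟩ := exists_equivariant_injective_of_irreducible π hπ α hα hα0
  refine hno ⟨ι ∘ₗ α, -(ι ∘ₗ β), fun g f => ?_, fun g f => ?_, ?_, ?_⟩
  · rw [LinearMap.comp_apply, LinearMap.comp_apply, hα, hι]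
  · rw [LinearMap.neg_apply, LinearMap.neg_apply, LinearMap.comp_apply, LinearMap.comp_apply, hβ, hι]
    funext y
    rfl
  · rw [LinearMap.neg_apply, LinearMap.comp_apply, LinearMap.comp_apply, ← map_neg,
      eq_neg_of_add_eq_zero_left hsum]
  · rw [LinearMap.comp_apply]
    exact fun h0 => hne (hιinj (by rw [h0, map_zero]))

variable [Nonempty I] [∀ i, Nonempty (E i)]

/-- **THE EXACT CRITERION ON THE PIVOT.**  Two-slot family of CM types, equivariant surjections `r_κ : E_{i_κ} → Y` onto a
common finite `G`-set, fibre-transitive `N ⊆ ⟨pointwise stabilisers⟩`.  Then `rank(Φ₀, Φ₁) + 2 = rank Φ₀ + rank Φ₁ + 1`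
(`Hg(A₀ × A₁) = Hg(A₀) × Hg(A₁)`) **iff NO two `G`-equivariant endomorphisms `α, β` of `ℚ^Y` collide the shadows**,
`α(w₀) = β(w₁) ≠ 0`.  The additivity of the pair is a property of the two vectors `w₀, w₁ ∈ ℚ^Y` and of the Hecke
algebra `End_G(ℚ^Y)` alone. [cite: Gordon1999HodgeAVSurvey, §3 Theorem and 7.5–7.7] [cite: Mai1989, §2 Prop. 1 (proof)] -/
theorem typeRank_sigmaType_add_card_eq_iff_not_exists_shadow_collision {ρ : G} {Φ : ∀ i, Set (E i)}
    (h : ∀ i, IsCMTypeWith ρ (Φ i)) {i₀ i₁ : I} (hI : ∀ j, j = i₀ ∨ j = i₁) (h01 : i₀ ≠ i₁)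
    (r₀ : E i₀ → Y) (r₁ : E i₁ → Y)
    (hr₀ : ∀ (g : G) (x : E i₀), r₀ (g • x) = g • r₀ x) (hr₁ : ∀ (g : G) (x : E i₁), r₁ (g • x) = g • r₁ x)
    (hs₀ : Function.Surjective r₀) (hs₁ : Function.Surjective r₁) (N : Set G)
    (hN₀ : ∀ x x' : E i₀, r₀ x = r₀ x' → ∃ n ∈ N, n • x = x')
    (hN₁ : ∀ x x' : E i₁, r₁ x = r₁ x' → ∃ n ∈ N, n • x = x')
    (hNcl : N ⊆ Subgroup.closure ({g : G | ∀ x : E i₀, g • x = x} ∪ {g : G | ∀ x : E i₁, g • x = x})) :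
    typeRank G (sigmaType Φ) + Fintype.card I = (∑ i, typeRank G (Φ i)) + 1 ↔
      ¬ ∃ α β : (Y → ℚ) →ₗ[ℚ] (Y → ℚ),
        (∀ (g : G) (f : Y → ℚ), α (fun y => f (g⁻¹ • y)) = fun y => α f (g⁻¹ • y)) ∧
        (∀ (g : G) (f : Y → ℚ), β (fun y => f (g⁻¹ • y)) = fun y => β f (g⁻¹ • y)) ∧
        α (fun y => ∑ x ∈ Finset.univ.filter (fun x => r₀ x = y), antiVec (Φ i₀) (1 : G) x) =
          β (fun y => ∑ x ∈ Finset.univ.filter (fun x => r₁ x = y), antiVec (Φ i₁) (1 : G) x) ∧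
        α (fun y => ∑ x ∈ Finset.univ.filter (fun x => r₀ x = y), antiVec (Φ i₀) (1 : G) x) ≠ 0 := by
  refine ⟨fun hEq => ?_, fun hno => typeRank_sigmaType_add_card_eq_of_forall_map_le h
    (forall_map_slotExt_le_of_not_exists_shadow_collision hI h01 r₀ r₁ hr₀ hr₁ hs₀ hs₁ N hN₀ hN₁ hNcl hno)⟩
  rintro ⟨α, β, hα, hβ, heq, hne⟩
  exact absurd hEq (ne_of_lt (typeRank_sigmaType_add_card_lt_of_shadow_collision h h01 r₀ r₁ hr₀ hr₁
    (fun g (f : Y → ℚ) y => f (g⁻¹ • y)) α β hα hβ heq hne))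

/-- **Nondegeneracy form**: under the same hypotheses and with no collision of the shadows, `Σ` is nondegenerate iff both
members are. [cite: Gordon1999HodgeAVSurvey, §3 Theorem (2) and 7.5–7.6.1] -/
theorem typeRank_sigmaType_eq_iff_forall_of_not_exists_shadow_collision {ρ : G} {Φ : ∀ i, Set (E i)}
    (h : ∀ i, IsCMTypeWith ρ (Φ i)) {i₀ i₁ : I} (hI : ∀ j, j = i₀ ∨ j = i₁) (h01 : i₀ ≠ i₁)
    (r₀ : E i₀ → Y) (r₁ : E i₁ → Y)
    (hr₀ : ∀ (g : G) (x : E i₀), r₀ (g • x) = g • r₀ x) (hr₁ : ∀ (g : G) (x : E i₁), r₁ (g • x) = g • r₁ x)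
    (hs₀ : Function.Surjective r₀) (hs₁ : Function.Surjective r₁) (N : Set G)
    (hN₀ : ∀ x x' : E i₀, r₀ x = r₀ x' → ∃ n ∈ N, n • x = x')
    (hN₁ : ∀ x x' : E i₁, r₁ x = r₁ x' → ∃ n ∈ N, n • x = x')
    (hNcl : N ⊆ Subgroup.closure ({g : G | ∀ x : E i₀, g • x = x} ∪ {g : G | ∀ x : E i₁, g • x = x}))
    (hno : ¬ ∃ α β : (Y → ℚ) →ₗ[ℚ] (Y → ℚ),
      (∀ (g : G) (f : Y → ℚ), α (fun y => f (g⁻¹ • y)) = fun y => α f (g⁻¹ • y)) ∧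
      (∀ (g : G) (f : Y → ℚ), β (fun y => f (g⁻¹ • y)) = fun y => β f (g⁻¹ • y)) ∧
      α (fun y => ∑ x ∈ Finset.univ.filter (fun x => r₀ x = y), antiVec (Φ i₀) (1 : G) x) =
        β (fun y => ∑ x ∈ Finset.univ.filter (fun x => r₁ x = y), antiVec (Φ i₁) (1 : G) x) ∧
      α (fun y => ∑ x ∈ Finset.univ.filter (fun x => r₀ x = y), antiVec (Φ i₀) (1 : G) x) ≠ 0) :
    typeRank G (sigmaType Φ) = Fintype.card (Σ i, E i) / 2 + 1 ↔
      ∀ i, typeRank G (Φ i) = Fintype.card (E i) / 2 + 1 :=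
  typeRank_sigmaType_eq_iff_forall_of_forall_map_le h
    (forall_map_slotExt_le_of_not_exists_shadow_collision hI h01 r₀ r₁ hr₀ hr₁ hs₀ hs₁ N hN₀ hN₁ hNcl hno)

end Criterion

end Summit.HodgeConjecture.CorCM.IrrOdd

end
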